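import Literature.Barriers.RiemannHypothesis.FeketePolyaPositivityChowla
import Literature.NumberTheory.LFunctions.RHWave0
import Literature.NumberTheory.DiophantineGeometry.AbcWave0
import HarnessLib
import Summits.RiemannHypothesis.RiemannHypothesis.Theorems.NoSiegelZerosOddQuadratic

/-!
# Status of Chowla's induced-character conjecture: it implies the no-Siegel-zero conjecture (rh.S34)

Sibling of `Literature/Barriers/RiemannHypothesis/FeketePolyaPositivityChowla.lean`, which vendors the
parity-corrected Chowla induced-character conjecture `ChowlaInducedCharacterConjecture` (Louboutin 2003,
p. 207: "Following Heilbronn's result, it has then been conjectured that for any non-principal real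
character `ψ` there exists some induced character `χ` for which `m(χ) = 1` if `ψ` is odd and `m(χ) = 2`
if `ψ` is even, which implies `L(s, χ) > 0` for `s > 0` and `L(s, ψ) > 0` for `s > 0` […]. No
counterexample to this conjecture is known.") as an OPEN named `def … : Prop`, and proves there
(`ChowlaInducedCharacterConjecture.re_LFunction_pos`, `.no_real_zero`) that it forces `L(σ, χ) ≠ 0`
for every quadratic `χ ≠ χ₀` and every real `σ > 0`.

This file records, as kernel-checked implications, WHY the conjecture cannot be discharged from the
literature: it implies two statements the tree catalogues as open.

* `ChowlaInducedCharacterConjecture.noSiegelZeros` — the conjecture implies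
  `Literature.NumberTheory.LFunctions.NoSiegelZeros` (inventory id rh.S34, "no Siegel zeros": some
  `c > 0` with `L(σ, χ) ≠ 0` for `σ > 1 − c / log q`, all real primitive `χ` mod `q ≥ 3`; open).
  Proof: take `c = log 3`; for `q ≥ 3`, `1 − log 3 / log q ≥ 0`, so the range `σ > 1 − c / log q`
  lies inside `σ > 0`, where `.no_real_zero` applies (a primitive character mod `q ≥ 3` is not
  principal: `DirichletCharacter.eq_one_iff_conductor_eq_one`).
* `ChowlaInducedCharacterConjectureOdd.noSiegelZerosOddQuadratic` — already the ODD half of the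
  conjecture (`m(χ) = 1`, i.e. `S_1(·, ψ↑m) ≥ 0`, for odd `ψ`) implies
  `Literature.NumberTheory.DiophantineGeometry.NoSiegelZerosOddQuadratic`, the consequent of the
  Granville–Stark implication `granville_stark_noSiegelZeros` (abc.S22: uniform abc ⇒ no Siegel zeros
  for odd real primitive characters).

Nothing here asserts the conjecture; both theorems take it as a hypothesis. Louboutin's own theorems
(Theorem 1: `L(1, χ) ≤ 1 − log 2 ⇒ m(χ) = ∞`; Theorem 2: `m(χ_{3p})`) do not bear on the truth of the
induced-character conjecture and are not vendored here.

## References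

* [Louboutin2003] S. R. Louboutin, *Note on a hypothesis implying the non-vanishing of Dirichlet
  L-series `L(s, χ)` for `s > 0` and real characters `χ`*, Colloq. Math. 96 (2003), 207–212 (read in
  full; p. 207 quoted above, Theorems 1–2 p. 208).
* [MontgomeryVaughan2007] H. L. Montgomery, R. C. Vaughan, *Multiplicative Number Theory I*, CUP 2007,
  §11.2.1 Exercise 8.
-/

noncomputable section

namespace Literature.Barriers.RiemannHypothesis

open Literature.NumberTheory.LFunctions Literature.NumberTheory.DiophantineGeometry

/-- For `q ≥ 3` the threshold `1 − log 3 / log q` of a Siegel-zero-free interval with constant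
`c = log 3` is nonnegative, so `σ > 1 − log 3 / log q` forces `σ > 0`. [folklore] -/
theorem pos_of_siegel_threshold_lt {q : ℕ} (hq : 3 ≤ q) {σ : ℝ}
    (hσ : 1 - Real.log 3 / Real.log q < σ) : 0 < σ := by
  have h3 : (3 : ℝ) ≤ q := by exact_mod_cast hq
  have h3q : Real.log 3 ≤ Real.log q := Real.log_le_log (by norm_num) h3
  have hlogq : 0 < Real.log (q : ℝ) := (Real.log_pos (by norm_num : (1 : ℝ) < 3)).trans_le h3q
  have hle : Real.log 3 / Real.log q ≤ 1 := (div_le_one hlogq).2 h3q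
  linarith

/-- A primitive Dirichlet character mod `q ≥ 3` (indeed mod `q ≥ 2`) is not principal: the
principal character has conductor `1` (`DirichletCharacter.eq_one_iff_conductor_eq_one`). [folklore] -/
theorem ne_one_of_isPrimitive_of_three_le {q : ℕ} [NeZero q] (hq : 3 ≤ q)
    {χ : DirichletCharacter ℂ q} (hχ : χ.IsPrimitive) : χ ≠ 1 := by
  intro h1
  have hc : χ.conductor = 1 := DirichletCharacter.eq_one_iff_conductor_eq_one.1 h1
  have hq' : χ.conductor = q := hχ
  omega

/-- **Status: Chowla's induced-character conjecture implies the no-Siegel-zero conjecture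
(rh.S34).** If for every primitive quadratic `ψ` some induced character `ψ↑m` has `S_1 ≥ 0`
(`ψ` odd) resp. `S_2 ≥ 0` (`ψ` even) — "it has then been conjectured that for any non-principal
real character `ψ` there exists some induced character `χ` for which `m(χ) = 1` if `ψ` is odd and
`m(χ) = 2` if `ψ` is even, which implies `L(s, χ) > 0` for `s > 0` and `L(s, ψ) > 0` for `s > 0`"
— then `Literature.NumberTheory.LFunctions.NoSiegelZeros` holds, with the constant `c = log 3`:
for `q ≥ 3` the interval `σ > 1 − log 3 / log q` lies in `σ > 0`, where
`ChowlaInducedCharacterConjecture.no_real_zero` excludes zeros of `L(σ, χ)` for every quadratic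
`χ ≠ χ₀`. In particular discharging the conjecture would settle the open statement rh.S34.
[cite: Louboutin2003, p. 207] -/
theorem ChowlaInducedCharacterConjecture.noSiegelZeros (h : ChowlaInducedCharacterConjecture) :
    NoSiegelZeros := by
  refine ⟨Real.log 3, Real.log_pos (by norm_num), fun q _ hq χ hquad hprim σ hσ ↦ ?_⟩
  exact h.no_real_zero χ (ne_one_of_isPrimitive_of_three_le hq hprim) hquad
    (pos_of_siegel_threshold_lt hq hσ)

/-- **Status, odd half: the odd case of Chowla's induced-character conjecture implies that odd real
primitive characters have no Siegel zeros** (`NoSiegelZerosOddQuadratic`, the consequent of the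
Granville–Stark implication abc.S22), again with `c = log 3`: for odd quadratic `χ ≠ χ₀`,
`ChowlaInducedCharacterConjectureOdd.re_LFunction_pos` gives `0 < Re L(σ, χ)` for all `σ > 0`
("`m(χ) = 1` if `ψ` is odd … which implies `L(s, χ) > 0` for `s > 0` and `L(s, ψ) > 0` for `s > 0`").
[cite: Louboutin2003, p. 207] -/
theorem ChowlaInducedCharacterConjectureOdd.noSiegelZerosOddQuadratic
    (h : ChowlaInducedCharacterConjectureOdd) : Summit.RiemannHypothesis.RiemannHypothesis.NoSiegelZerosOddQuadratic := by
  refine ⟨Real.log 3, Real.log_pos (by norm_num), fun q _ hq χ hquad hprim hodd σ hσ ↦ ?_⟩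
  intro h0
  have hpos := h.re_LFunction_pos χ (ne_one_of_isPrimitive_of_three_le hq hprim) hquad hodd
    (pos_of_siegel_threshold_lt hq hσ)
  rw [h0, Complex.zero_re] at hpos
  exact lt_irrefl _ hpos

end Literature.Barriers.RiemannHypothesis

end
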